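import Literature.Geometry.Symplectic.TaubesCanonicalClassCurveUpToSign
import Literature.Geometry.Symplectic.CanonicalSpincStructure
import Literature.Geometry.Symplectic.CompatibleAlmostComplexStructureExists
import Literature.Geometry.GaugeTheory.SeibergWittenInvariantModTwo
import Literature.Geometry.Lorentzian.LeviCivitaProofs
import HarnessLib

/-!
# Taubes 1995, Thm. A (1), sign-free form: the reduction to Taubes 1994 and `SW ⇒ Gr` (proofs)

Topic `Literature/Geometry/Symplectic`; the proof file of
`TaubesCanonicalClassCurveUpToSign.lean` (which holds only the two named facts).  Theorems only;
no named facts are introduced here.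

C. H. Taubes, *The Seiberg–Witten and Gromov invariants*, Math. Res. Lett. 2 (1995), §4 p. 231
(proof of Thm. A from Thm. 4.1): Thm. A (1) is Prop. 4.2 for `E = K` ("In particular, the
Poincaré dual to `c₁(K)` is represented by a symplectic curve") fed with [T2] = Taubes 1994
("the Seiberg–Witten invariants are `±1` for the cases `E = I, K` in (2.2)", §2 p. 226).  This file
PROVES exactly this deduction on the tree:

* the glue that needs no Seiberg–Witten theory: when `K_J = 0` the empty Taubes curve represents
  `PD(K_J) = 0` (McDuff–Salamon 2017, Cor. 13.3.23: "If `A = 0` then `C = ∅`"), and each one-signed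
  form of the conclusion gives the sign-free one (`exists_hasTaubesCurve_of_*`, the assembly routes
  `…_of_canonicalClass` / `…_of_firstChernClass`);
* **`taubes1995_hasTaubesCurve_canonicalClass_of_two_le_bPlus_of_taubes1994_of_swToGr`**: the
  named fact follows from its two printed inputs, stated in the tree's currency (the canonical
  `Spin^c` structure `canonicalSpincStructure` of `(N, s, J)` over `(N, g_J, o_s)` and the
  degenerate-safe mod-2 invariant `swInvariantModTwo`) as the two explicit HYPOTHESES of the
  theorem — [T2] = Taubes 1994, Main Theorem, mod 2: `SW₂(𝔰_J) = 1` when `b⁺ ≥ 2`; and Prop. 4.2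
  for `E = K`: `K_J ≠ 0` and `SW₂(𝔰̄_J) ≠ 0` give a Taubes curve Poincaré dual to the canonical
  class (sign-free) — and the deduction PROVED: choose an `s`-compatible `J`
  (`exists_almostComplexStructure_isCompatibleWith`), the Levi-Civita connection of `g_J`
  (`hasLeviCivita`); if `K_J = 0` the empty curve; otherwise charge conjugation
  (`swInvariantModTwo_conjugate`) carries `SW₂(𝔰_J) = 1` to the structure `S⁺ = K ⊕ I` of `E = K`
  and Prop. 4.2 applies.  The two hypotheses are apex-sized published theorems (the Seiberg–Witten
  moduli analysis and `SW ⇒ Gr`); they are NOT vendored as named facts by this (proving) unit —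
  D-0026 — and are the inputs a route-level split would file.

## References

* C. H. Taubes, *The Seiberg–Witten and Gromov invariants*, Math. Res. Lett. 2 (1995) 221–238,
  Thm. A (1), §2 p. 226, Prop. 4.2 p. 231. [Taubes1995]
* C. H. Taubes, *The Seiberg–Witten invariants and symplectic forms*, Math. Res. Lett. 1 (1994)
  809–822, Main Theorem. [Taubes1994]
* D. McDuff, D. Salamon, *Introduction to Symplectic Topology*, 3rd ed. (2017), Cor. 13.3.23.
  [McDuffSalamon2017]
-/

noncomputable section

namespace Literature.Geometry.Symplectic

open scoped _root_.Manifold ContDiff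
open Literature.Geometry.Kaehler (MForm IsSmoothForm IsClosedForm)
open Literature.AlgebraicTopology.SingularHomology Literature.Geometry.GaugeTheory

/-! ### The glue of Thm. A (1) that needs no Seiberg–Witten theory -/

section Glue

variable {N : Type} [TopologicalSpace N] [T2Space N] [CompactSpace N]
  [ChartedSpace (EuclideanSpace ℝ (Fin 4)) N] [IsManifold (𝓡 4) ∞ N]

/-- **The case `K_J = 0` of Taubes's Thm. A (1), sign-free form**: for an `s`-compatible `J` with
vanishing canonical class the empty Taubes curve represents `K_J ⌢ [N]_μ = 0` (Prop. 4.2 only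
concerns non-trivial `E`; "If `A = 0` then `C = ∅`", McDuff–Salamon 2017, Cor. 13.3.23).
[cite: Taubes1995, Prop. 4.2 (p. 231)] [cite: McDuffSalamon2017, Cor. 13.3.23] -/
theorem exists_hasTaubesCurve_of_canonicalClass_eq_zero (s : MForm (𝓡 4) N ℝ 2)
    (hs : IsSmoothForm s) (hcl : IsClosedForm s) (μ : HomologicalOrientation ℤ N 4)
    (J : AlmostComplexStructure (𝓡 4) ∞ N) (hJ : J.IsCompatibleWith s) (hK : J.canonicalClass = 0) :
    ∃ J : AlmostComplexStructure (𝓡 4) ∞ N, J.IsCompatibleWith s ∧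
      ∃ K : singularCohomology ℤ ℤ N 2, (K = J.canonicalClass ∨ K = J.firstChernClass) ∧
        HasTaubesCurve s hs hcl μ K K :=
  ⟨J, hJ, 0, Or.inl hK.symm, hasTaubesCurve_zero s hs hcl μ 0⟩

/-- The same with the hypothesis `c₁(TN, J) = 0` (`K_J = -c₁`). [cite: Taubes1995, Prop. 4.2 (p. 231)] -/
theorem exists_hasTaubesCurve_of_firstChernClass_eq_zero (s : MForm (𝓡 4) N ℝ 2)
    (hs : IsSmoothForm s) (hcl : IsClosedForm s) (μ : HomologicalOrientation ℤ N 4)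
    (J : AlmostComplexStructure (𝓡 4) ∞ N) (hJ : J.IsCompatibleWith s) (hc : J.firstChernClass = 0) :
    ∃ J : AlmostComplexStructure (𝓡 4) ∞ N, J.IsCompatibleWith s ∧
      ∃ K : singularCohomology ℤ ℤ N 2, (K = J.canonicalClass ∨ K = J.firstChernClass) ∧
        HasTaubesCurve s hs hcl μ K K :=
  ⟨J, hJ, 0, Or.inr hc.symm, hasTaubesCurve_zero s hs hcl μ 0⟩

/-- **A Taubes curve in the class `K_J` gives the sign-free conclusion** (first assembly route:
the tree's `c₁` agrees with the books'). [cite: Taubes1995, Thm. A (1)] -/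
theorem exists_hasTaubesCurve_of_hasTaubesCurve_canonicalClass (s : MForm (𝓡 4) N ℝ 2)
    (hs : IsSmoothForm s) (hcl : IsClosedForm s) (μ : HomologicalOrientation ℤ N 4)
    (J : AlmostComplexStructure (𝓡 4) ∞ N) (hJ : J.IsCompatibleWith s)
    (hC : HasTaubesCurve s hs hcl μ J.canonicalClass J.canonicalClass) :
    ∃ J : AlmostComplexStructure (𝓡 4) ∞ N, J.IsCompatibleWith s ∧
      ∃ K : singularCohomology ℤ ℤ N 2, (K = J.canonicalClass ∨ K = J.firstChernClass) ∧
        HasTaubesCurve s hs hcl μ K K :=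
  ⟨J, hJ, J.canonicalClass, Or.inl rfl, hC⟩

/-- **A Taubes curve in the class `c₁(TN, J)` gives the sign-free conclusion** (second assembly
route: the tree's `c₁` is the negative of the books'). [cite: Taubes1995, Thm. A (1)] -/
theorem exists_hasTaubesCurve_of_hasTaubesCurve_firstChernClass (s : MForm (𝓡 4) N ℝ 2)
    (hs : IsSmoothForm s) (hcl : IsClosedForm s) (μ : HomologicalOrientation ℤ N 4)
    (J : AlmostComplexStructure (𝓡 4) ∞ N) (hJ : J.IsCompatibleWith s)
    (hC : HasTaubesCurve s hs hcl μ J.firstChernClass J.firstChernClass) :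
    ∃ J : AlmostComplexStructure (𝓡 4) ∞ N, J.IsCompatibleWith s ∧
      ∃ K : singularCohomology ℤ ℤ N 2, (K = J.canonicalClass ∨ K = J.firstChernClass) ∧
        HasTaubesCurve s hs hcl μ K K :=
  ⟨J, hJ, J.firstChernClass, Or.inr rfl, hC⟩

end Glue

/-! ### The assembly routes through the one-signed forms -/

/-- **First assembly route for the named fact**: the printed one-signed theorem "for `b⁺ ≥ 2`
some `s`-compatible `J` has a Taubes curve in the class `K_J`" implies the sign-free fact.
[cite: Taubes1995, Thm. A (1), §3 (3.2), Prop. 4.2] -/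
theorem taubes1995_hasTaubesCurve_canonicalClass_of_two_le_bPlus_of_canonicalClass
    (h : ∀ (N : Type) [TopologicalSpace N] [T2Space N] [SecondCountableTopology N]
      [CompactSpace N] [ConnectedSpace N] [ChartedSpace (EuclideanSpace ℝ (Fin 4)) N]
      [IsManifold (𝓡 4) ∞ N]
      (s : MForm (𝓡 4) N ℝ 2) (hs : IsSmoothForm s) (hcl : IsClosedForm s)
      (_ : ∀ x (v : TangentSpace (𝓡 4) x), v ≠ 0 → ∃ w : TangentSpace (𝓡 4) x, s x ![v, w] ≠ 0)
      (μ : HomologicalOrientation ℤ N 4), μ.IsSymplecticOrientationOf s hs hcl →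
      2 ≤ sigPos (intersectionForm two_add_two_eq_four μ).toQuadraticMap →
      ∃ J : AlmostComplexStructure (𝓡 4) ∞ N, J.IsCompatibleWith s ∧
        HasTaubesCurve s hs hcl μ J.canonicalClass J.canonicalClass) :
    taubes1995_hasTaubesCurve_canonicalClass_of_two_le_bPlus := by
  intro N _ _ _ _ _ _ _ s hs hcl hnd μ hμ hb
  obtain ⟨J, hJ, hC⟩ := h N s hs hcl hnd μ hμ hb
  exact exists_hasTaubesCurve_of_hasTaubesCurve_canonicalClass s hs hcl μ J hJ hC

/-- **Second assembly route for the named fact**: the one-signed theorem with the class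
`c₁(TN, J)` (the printed theorem if the tree's `c₁` is the negative of the books') implies the
sign-free fact. [cite: Taubes1995, Thm. A (1), §3 (3.2), Prop. 4.2] -/
theorem taubes1995_hasTaubesCurve_canonicalClass_of_two_le_bPlus_of_firstChernClass
    (h : ∀ (N : Type) [TopologicalSpace N] [T2Space N] [SecondCountableTopology N]
      [CompactSpace N] [ConnectedSpace N] [ChartedSpace (EuclideanSpace ℝ (Fin 4)) N]
      [IsManifold (𝓡 4) ∞ N]
      (s : MForm (𝓡 4) N ℝ 2) (hs : IsSmoothForm s) (hcl : IsClosedForm s)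
      (_ : ∀ x (v : TangentSpace (𝓡 4) x), v ≠ 0 → ∃ w : TangentSpace (𝓡 4) x, s x ![v, w] ≠ 0)
      (μ : HomologicalOrientation ℤ N 4), μ.IsSymplecticOrientationOf s hs hcl →
      2 ≤ sigPos (intersectionForm two_add_two_eq_four μ).toQuadraticMap →
      ∃ J : AlmostComplexStructure (𝓡 4) ∞ N, J.IsCompatibleWith s ∧
        HasTaubesCurve s hs hcl μ J.firstChernClass J.firstChernClass) :
    taubes1995_hasTaubesCurve_canonicalClass_of_two_le_bPlus := by
  intro N _ _ _ _ _ _ _ s hs hcl hnd μ hμ hb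
  obtain ⟨J, hJ, hC⟩ := h N s hs hcl hnd μ hμ hb
  exact exists_hasTaubesCurve_of_hasTaubesCurve_firstChernClass s hs hcl μ J hJ hC

/-! ### The reduction of Thm. A (1) to Taubes 1994 and Prop. 4.2 (`SW ⇒ Gr`) -/

/-- **Taubes 1995, Thm. A (1) from [T2] and Prop. 4.2** (the printed deduction, §4 p. 231 with §2
p. 226).  Hypothesis `h₁` is Taubes 1994, Main Theorem (p. 809: "Let `X` be a compact, oriented,
4 dimensional manifold with `b₂⁺ ≥ 2`. Let `ω` be a symplectic form on `X` with `ω ∧ ω` giving the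
orientation. Then the first Chern class of the associated almost complex structure on `X` has
Seiberg–Witten invariant equal to `±1`"; the structure `S⁺ ≈ I ⊕ K⁻¹` of §1 there) read mod `2` in
the tree's currency: for the canonical `Spin^c` structure of `(N, s, J)` over `(N, g_J, o_s)` and the
Levi-Civita connection, `swInvariantModTwo = 1` (residual filter proper and generic moduli space
finite of odd cardinality; `d = 0` here, `b⁺ ≥ 2` explicit).  Hypothesis `h₂` is Taubes 1995,
Prop. 4.2 (p. 231) for `E = K` ("Let … `E` be a nontrivial complex line bundle for which the
associated `Spin^c` structure (as in (2.2)) has nonzero Seiberg–Witten invariant. Then the Poincaré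
dual to `c₁(E)` is represented by … an embedded, symplectic curve … In particular, the Poincaré
dual to `c₁(K)` is represented by a symplectic curve"; proved in Taubes 1996; McDuff–Salamon 2017,
Thm. 13.3.21 and Cor. 13.3.23): the structure of `E = K`, `S⁺ = K ⊕ I`, is the conjugate of the
canonical one, "nontrivial" is `K_J ≠ 0`, "nonzero invariant" is rendered (more strongly) by
`swInvariantModTwo ≠ 0`, and the curve is a Taubes curve in the class `K_J` or `c₁(TN, J)`
(sign-free, as the fact).  PROOF of the deduction: an `s`-compatible `J` exists (McDuff–Salamon
Prop. 4.1.1 (i)); if `K_J = 0` the empty curve represents it; otherwise `h₁` and charge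
conjugation (`swInvariantModTwo_conjugate`, Morgan Cor. 6.8.4) give `SW₂(𝔰̄_J) = 1 ≠ 0` and `h₂`
the curve. [cite: Taubes1995, Thm. A (1); §2 p. 226; Prop. 4.2 p. 231] [cite: Taubes1994, Main Theorem (p. 809)] -/
theorem taubes1995_hasTaubesCurve_canonicalClass_of_two_le_bPlus_of_taubes1994_of_swToGr
    (h₁ : ∀ (N : Type) [TopologicalSpace N] [T2Space N] [SecondCountableTopology N]
      [CompactSpace N] [ConnectedSpace N] [ChartedSpace (EuclideanSpace ℝ (Fin 4)) N]
      [IsManifold (𝓡 4) ∞ N]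
      (s : MForm (𝓡 4) N ℝ 2) (hs : IsSmoothForm s) (hcl : IsClosedForm s)
      (hnd : ∀ x (v : TangentSpace (𝓡 4) x), v ≠ 0 → ∃ w : TangentSpace (𝓡 4) x, s x ![v, w] ≠ 0)
      (μ : HomologicalOrientation ℤ N 4), μ.IsSymplecticOrientationOf s hs hcl →
      2 ≤ sigPos (intersectionForm two_add_two_eq_four μ).toQuadraticMap →
      ∀ (J : AlmostComplexStructure (𝓡 4) ∞ N) (hJ : J.IsCompatibleWith s)
        [(hJ.metric hs).HasLeviCivita],
        (hJ.canonicalSpincStructure hs hnd).swInvariantModTwo = 1)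
    (h₂ : ∀ (N : Type) [TopologicalSpace N] [T2Space N] [SecondCountableTopology N]
      [CompactSpace N] [ConnectedSpace N] [ChartedSpace (EuclideanSpace ℝ (Fin 4)) N]
      [IsManifold (𝓡 4) ∞ N]
      (s : MForm (𝓡 4) N ℝ 2) (hs : IsSmoothForm s) (hcl : IsClosedForm s)
      (hnd : ∀ x (v : TangentSpace (𝓡 4) x), v ≠ 0 → ∃ w : TangentSpace (𝓡 4) x, s x ![v, w] ≠ 0)
      (μ : HomologicalOrientation ℤ N 4), μ.IsSymplecticOrientationOf s hs hcl →
      2 ≤ sigPos (intersectionForm two_add_two_eq_four μ).toQuadraticMap →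
      ∀ (J : AlmostComplexStructure (𝓡 4) ∞ N) (hJ : J.IsCompatibleWith s)
        [(hJ.metric hs).HasLeviCivita],
        J.canonicalClass ≠ 0 →
        (hJ.canonicalSpincStructure hs hnd).conjugate.swInvariantModTwo ≠ 0 →
        ∃ K : singularCohomology ℤ ℤ N 2, (K = J.canonicalClass ∨ K = J.firstChernClass) ∧
          HasTaubesCurve s hs hcl μ K K) :
    taubes1995_hasTaubesCurve_canonicalClass_of_two_le_bPlus := by
  intro N _ _ _ _ _ _ _ s hs hcl hnd μ hμ hb
  obtain ⟨J, hJ⟩ := exists_almostComplexStructure_isCompatibleWith s hs hnd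
  by_cases hK : J.canonicalClass = 0
  · exact exists_hasTaubesCurve_of_canonicalClass_eq_zero s hs hcl μ J hJ hK
  · haveI : Fact (1 ≤ (∞ : ℕ∞ω)) := ⟨by exact_mod_cast le_top⟩
    haveI : (hJ.metric hs).HasLeviCivita := (hJ.metric hs).hasLeviCivita
    have hsw : (hJ.canonicalSpincStructure hs hnd).swInvariantModTwo = 1 :=
      h₁ N s hs hcl hnd μ hμ hb J hJ
    have hne : (hJ.canonicalSpincStructure hs hnd).conjugate.swInvariantModTwo ≠ 0 := by
      rw [SpincStructure.swInvariantModTwo_conjugate, hsw]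
      exact one_ne_zero
    obtain ⟨K, hK', hC⟩ := h₂ N s hs hcl hnd μ hμ hb J hJ hK hne
    exact ⟨J, hJ, K, hK', hC⟩

end Literature.Geometry.Symplectic

end
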